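import Summits.BirchSwinnertonDyer.BirchSwinnertonDyer.Theorems.ClassRecordThreeShimuraKolyvaginOrderBoundAtThreeRungSEmpty
import HarnessLib

/-!
# BC5 rung `stub_rung_orderBound_SEmptyFromFive` of crux `ShimuraKolyvaginOrderBoundFromFive` (item
# 19627, route ErratumRoadFive, `5 ≤ p ∥ N⁺`): the `S = ∅` signature on the two printed regimes

Cell `bsd-stepL`, seat `bsd-stepL-shim-p2`. The K2 annex crux stmt-BirchSwinnertonDyer-19627
`ShimuraKolyvaginOrderBoundFromFive` has the same registered skeleton shape as 19616 with `5 ≤ p` in place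
of `p = 3` (`Cruxes/ShimuraKolyvaginOrderBoundFromFive/Lines/birth.lean`, rung
`stub_rung_orderBound_SEmptyFromFive`). HONEST FRAMING: at `p ≥ 5` the split prime `p` no longer excludes
`K ∈ {ℚ(i), ℚ(√-3)}`, and the printed order bounds in the tree are Matar–Nekovář 2019 Thm. 0.3 + §0.11
(irreducible `E[p]`, standing `D_K ≠ -3, -4`) and Kolyvagin 1990 / McCallum 1991 (SURJECTIVE `ρ̄_{E,p}`,
no restriction on `D_K` printed). So the registered signature is proved here VERBATIM EXCEPT for ONE
added clause each: `stub_rung_orderBound_SEmptyFromFive_of_published_of_discr_ne` (adds `d_K ≠ -3`,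
`d_K ≠ -4`) and `stub_rung_orderBound_SEmptyFromFive_of_published_of_surj` (adds
`Rank1Residual.Surj W p`); together they cover the rung off `{d_K ∈ {-3,-4}} ∩ {E[p] irreducible, ρ̄ not
onto}`, for which no printed statement is typed in the tree. CONDITIONAL on the named facts
`gross_zagier`, `kolyvagin` and `MatarNekovar2019.thm03_…` resp. `Kolyvagin1990_padicValNat_card_sha_le`;
landed `--supports 19627 --as helper`; THEOREMS ONLY; nothing booked; the crux proper (`S ≠ ∅`) is
untouched. The transfer `y ↦ P` is `card_sha_primaryComponent_le_of_petersson_display` of the AtThree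
file. [cite: MatarNekovar2019, Thm. 0.3, §0.4, §0.11 (pp. 456–457)] [cite: McCallumLMS1991, §1 Theorem
(Kolyvagin), p. 296]

References: [Cha2005] Thm. 21; [MatarNekovar2019] Thm. 0.3, §0.11; [McCallumLMS1991] §1; [GrossLMS1991]
(1.1), Thm. 1.3 (2); [CaiShuTian2014] Thm. 1.1; [PastenShimura2024] §2 p. 12.
-/

noncomputable section

open scoped Classical

set_option linter.dupNamespace false

open WeierstrassCurve NumberField Literature.NumberTheory.EllipticCurves
  Literature.NumberTheory.EllipticCurves.ModularForms
  Literature.NumberTheory.EllipticCurves.Rank1Residual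
  Literature.NumberTheory.Automorphic CongruenceSubgroup

namespace Summit.BirchSwinnertonDyer.BirchSwinnertonDyer.Theorems.ShimuraKolyvaginRungSEmpty

/-! ### The two printed regimes at `S = ∅`, `p` odd -/

/-- **The `S = ∅` rung at ANY odd prime, irreducible image, `d_K ≠ -3, -4`** — the signature of the
twin rung `stub_rung_orderBound_SEmptyFromFive` of crux `ShimuraKolyvaginOrderBoundFromFive` (item
stmt-BirchSwinnertonDyer-19627, route ErratumRoadFive, `5 ≤ p`) with the two clauses `d_K ≠ -3`,
`d_K ≠ -4` ADDED right after `IsImaginaryQuadratic K` (Matar–Nekovář's / Kolyvagin's standing hypothesis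
`D_K ≠ -3, -4`; at `p ≥ 5` the split prime `p` no longer excludes `ℚ(√-3)`, `ℚ(i)`); the clause `5 ≤ p`
is kept verbatim but only `p ≠ 2` is used. From the three named facts `gross_zagier`, `kolyvagin`,
`MatarNekovar2019.thm03_padicValNat_card_sha_le_of_irreducible`. [cite: MatarNekovar2019, Thm. 0.3 (p. 456), §0.4, §0.11 (p. 457)] [cite: Cha2005, Thm. 21 (p. 173)] -/
theorem stub_rung_orderBound_SEmptyFromFive_of_published_of_discr_ne
    (hGZ : ∀ (N : ℕ) [NeZero N] (W : WeierstrassCurve ℚ) (K : Type) [Field K] [NumberField K],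
      gross_zagier N W K)
    (hKol : ∀ (N : ℕ) [NeZero N] (W : WeierstrassCurve ℚ) (K : Type) [Field K] [NumberField K],
      kolyvagin N W K)
    (hMN : ∀ (N : ℕ) [NeZero N] (W : WeierstrassCurve ℚ) (K : Type) [Field K] [NumberField K],
      MatarNekovar2019.thm03_padicValNat_card_sha_le_of_irreducible N W K) :
  ∀ (W : WeierstrassCurve ℚ) [W.IsElliptic] [W.IsGloballyMinimal] (p : ℕ) [Fact p.Prime]
    (N : ℕ) [NeZero N] (K : Type) [Field K] [NumberField K] (S : Finset ℕ)
    (Dt : ModularParametrizationData W N)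
    (X : ShimuraCurveData (∏ q ∈ S, q) (N / ∏ q ∈ S, q))
    (W' : WeierstrassCurve ℚ) [W'.IsElliptic] (P₀ : ShimuraParametrizationData X W'),
    W.conductorNorm ℤ = N → S = ∅ → p ≠ 2 → W.HasIrreducibleModPGaloisRep p →
    IsImaginaryQuadratic K → NumberField.discr K ≠ -3 → NumberField.discr K ≠ -4 → Even S.card →
    (∀ ℓ ∈ S, ℓ.Prime ∧ ℓ ∣ N ∧ ¬ ℓ ^ 2 ∣ N ∧
      ((Ideal.span {(ℓ : ℤ)}).primesOver (𝓞 K)).ncard = 1 ∧ ¬ (ℓ : ℤ) ∣ NumberField.discr K) →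
    (∀ ℓ : ℕ, ℓ.Prime → ℓ ∣ N → ℓ ∉ S → ((Ideal.span {(ℓ : ℤ)}).primesOver (𝓞 K)).ncard = 2) →
    ((Ideal.span {(p : ℤ)}).primesOver (𝓞 K)).ncard = 2 →
    P₀.IsMinimalFor W →
    p ∣ N → 5 ≤ p →
    ∀ (P : (W.baseChange K).toAffine.Point) (degS : ℕ), 0 < degS →
      padicValNat p degS = padicValNat p P₀.deg →
      LDerivEK W K =
        8 * (Real.pi : ℂ) ^ 2 * peterssonProduct (Gamma0 N) 2 Dt.f Dt.f /
            ((((Units.torsionOrder K : ℝ) / 2) ^ 2 * √|(NumberField.discr K : ℝ)| : ℝ) : ℂ) *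
          ((P.canonicalHeight : ℂ) / (degS : ℂ)) →
      ¬ IsOfFinAddOrder P →
        Nat.card (AddCommGroup.primaryComponent (W.baseChange K).sha p) ≤
          p ^ (2 * padicValNat p (AddSubgroup.zmultiples P).index) := by
  intro W _ _ p _ N _ K _ _ S Dt X W' _ P₀ hN hS hp2 hirr hK hD3 hD4 _ _ hsplitN _ hP₀ _ _ P degS hdegS
    hval hGZP hPnt
  subst hS
  have hp : p.Prime := Fact.out
  have hH : SatisfiesHeegnerHypothesis N K := fun ℓ hℓ hℓN ↦ hsplitN ℓ hℓ hℓN (Finset.notMem_empty ℓ)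
  exact card_sha_primaryComponent_le_of_petersson_display W K (hGZ N W K) (hKol N W K)
    (fun hy hynt ↦ hMN N W K hK hH hD3 hD4 hy hynt hp hp2 hirr) hN hp hirr hK hH Dt X
    Finset.prod_empty (by rw [Finset.prod_empty, Nat.div_one]) P₀ hP₀ P hdegS hval hGZP hPnt

/-- **The `S = ∅` rung at ANY odd prime in the SURJECTIVE-image regime, every `d_K`** — the same
registered signature with ONE clause `Rank1Residual.Surj W p` ADDED right after `S = ∅` (the image
regime of the registered stub `stub_orderBound_surjFromFive`), every `d_K`, from
Gross–Zagier, `kolyvagin` and Kolyvagin 1990 Thm. A / McCallum 1991 §1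
(`Kolyvagin1990_padicValNat_card_sha_le`, no restriction on `d_K` printed). With
`stub_rung_orderBound_SEmptyFromFive_of_published_of_discr_ne` this covers the `S = ∅` rung of crux
`ShimuraKolyvaginOrderBoundFromFive` except on `{d_K ∈ {-3,-4}} ∩ {ρ̄_{E,p} irreducible, not onto}`.
[cite: McCallumLMS1991, §1 Theorem (Kolyvagin), p. 296] [cite: GrossLMS1991, §1 Thm. 1.3 (2), p. 236] -/
theorem stub_rung_orderBound_SEmptyFromFive_of_published_of_surj
    (hGZ : ∀ (N : ℕ) [NeZero N] (W : WeierstrassCurve ℚ) (K : Type) [Field K] [NumberField K],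
      gross_zagier N W K)
    (hKol : ∀ (N : ℕ) [NeZero N] (W : WeierstrassCurve ℚ) (K : Type) [Field K] [NumberField K],
      kolyvagin N W K)
    (hKo : ∀ (N : ℕ) [NeZero N] (W : WeierstrassCurve ℚ) (K : Type) [Field K] [NumberField K],
      Kolyvagin1990_padicValNat_card_sha_le N W K) :
  ∀ (W : WeierstrassCurve ℚ) [W.IsElliptic] [W.IsGloballyMinimal] (p : ℕ) [Fact p.Prime]
    (N : ℕ) [NeZero N] (K : Type) [Field K] [NumberField K] (S : Finset ℕ)
    (Dt : ModularParametrizationData W N)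
    (X : ShimuraCurveData (∏ q ∈ S, q) (N / ∏ q ∈ S, q))
    (W' : WeierstrassCurve ℚ) [W'.IsElliptic] (P₀ : ShimuraParametrizationData X W'),
    W.conductorNorm ℤ = N → S = ∅ → Rank1Residual.Surj W p → p ≠ 2 → W.HasIrreducibleModPGaloisRep p →
    IsImaginaryQuadratic K → Even S.card →
    (∀ ℓ ∈ S, ℓ.Prime ∧ ℓ ∣ N ∧ ¬ ℓ ^ 2 ∣ N ∧
      ((Ideal.span {(ℓ : ℤ)}).primesOver (𝓞 K)).ncard = 1 ∧ ¬ (ℓ : ℤ) ∣ NumberField.discr K) →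
    (∀ ℓ : ℕ, ℓ.Prime → ℓ ∣ N → ℓ ∉ S → ((Ideal.span {(ℓ : ℤ)}).primesOver (𝓞 K)).ncard = 2) →
    ((Ideal.span {(p : ℤ)}).primesOver (𝓞 K)).ncard = 2 →
    P₀.IsMinimalFor W →
    p ∣ N → 5 ≤ p →
    ∀ (P : (W.baseChange K).toAffine.Point) (degS : ℕ), 0 < degS →
      padicValNat p degS = padicValNat p P₀.deg →
      LDerivEK W K =
        8 * (Real.pi : ℂ) ^ 2 * peterssonProduct (Gamma0 N) 2 Dt.f Dt.f /
            ((((Units.torsionOrder K : ℝ) / 2) ^ 2 * √|(NumberField.discr K : ℝ)| : ℝ) : ℂ) *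
          ((P.canonicalHeight : ℂ) / (degS : ℂ)) →
      ¬ IsOfFinAddOrder P →
        Nat.card (AddCommGroup.primaryComponent (W.baseChange K).sha p) ≤
          p ^ (2 * padicValNat p (AddSubgroup.zmultiples P).index) := by
  intro W _ _ p _ N _ K _ _ S Dt X W' _ P₀ hN hS hsurj hp2 hirr hK _ _ hsplitN _ hP₀ _ _ P degS hdegS
    hval hGZP hPnt
  subst hS
  have hp : p.Prime := Fact.out
  have hH : SatisfiesHeegnerHypothesis N K := fun ℓ hℓ hℓN ↦ hsplitN ℓ hℓ hℓN (Finset.notMem_empty ℓ)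
  exact card_sha_primaryComponent_le_of_petersson_display W K (hGZ N W K) (hKol N W K)
    (fun hy hynt ↦ hKo N W K hK hH hy hynt hp hp2 hsurj) hN hp hirr hK hH Dt X
    Finset.prod_empty (by rw [Finset.prod_empty, Nat.div_one]) P₀ hP₀ P hdegS hval hGZP hPnt
end Summit.BirchSwinnertonDyer.BirchSwinnertonDyer.Theorems.ShimuraKolyvaginRungSEmpty

end
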